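import Summits.HubbardSuperconductivity.HubbardSuperconductivity.Theorems.ThermalWedgeTwSourcedCondensationShallowWindow
import Literature.MathematicalPhysics.QuantumLattice.DWaveSourceTorusJointPressureEven
import HarnessLib

/-!
# Route `ThermalWedge`, crux `TwSourcedCondensation` (item `stmt-HubbardSuperconductivity-1697`):
# the crux inequality holds UNCONDITIONALLY at every fixed temperature, for small coupling

The crux asks, for every compact `[μ₁,μ₂] ⊂ (-4,0)`, constants `U₀ a c C h₀ > 0` such that for
`0 < U ≤ U₀`, `1 ≤ β ≤ e^{a/U}`, `μ ∈ [μ₁,μ₂]`, eventually in `L`, for `|h| ≤ h₀`: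
`c h² log(1/(|h|+1/β)) − C h² ≤ p̃_L(β,U,μ,h) − p̃_L(β,U,μ,0)`,
`p̃_L(β,U,μ,h) = log Re Z_β(dWaveSourceTorus L U μ h)/(βL²)` (the sourced torus pressure).

THEOREM (`twSourcedCondensation_fixedTemperature`, this file, no `sorry`, no hypothesis). For every
compact `[μ₁,μ₂] ⊂ (-4,0)` there are `c, C, h₀ > 0` such that for EVERY `β ≥ 1` and `μ ∈ [μ₁,μ₂]`
there is a coupling radius `U₁ = U₁(β,μ) > 0` with, eventually in `L` (threshold depending on `β, μ`),
for every real coupling `|U| ≤ U₁` and EVERY source `|h| ≤ h₀` (deep window `h² < |U|` included):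

  `c h² log(1/(|h|+1/β)) − C h² ≤ p̃_L(β,U,μ,h) − p̃_L(β,U,μ,0)`.

That is: the condensation (Cooper-logarithm) lower bound of the crux survives the weak repulsion at
every FIXED temperature, with the FREE constant `c = c₀(μ₁,μ₂)` and `C`, `h₀` uniform in `β`; what the
crux adds — and what this file does NOT assert — is the uniformity of the coupling radius down to
`T = e^{-a/U}` (`U₁` independent of `β ≤ e^{a/U}`), i.e. the multiscale (renormalised) expansion of
Benfatto–Giuliani–Mastropietro in place of the single-scale one used here (engine `(A)` of
`Cruxes/TwSourcedInertness/Lines/engine-interface-c2.md`, milestone M1 at fixed `β`).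

Proof. Two regimes in the source at fixed `(β, μ)`:
* shallow `|U| ≤ h²`: `twSourcedCondensation_shallowWindow` (p96342; entropy staircase with the crude
  slacks `|p̃_U − p̃_0| ≤ |U|`), constants `c, C_sw, h₀`;
* deep `h² < |U| ≤ U₁`: the single-scale determinant expansion of the sourced torus at fixed
  temperature, in the form of the mixed-increment bound
  `|log Z_L(U,h) − log Z_L(U,0) − log Z_L(0,h) + log Z_L(0,0)| ≤ K L²|U|h²` for `|U|,|h| ≤ δ(β,μ)`,
  `L ≥ 3` (`dWaveSourceTorus_log_partitionFn_mixed_increment_le_sq`, p129311), gives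
  `p̃_L(U,h) − p̃_L(U,0) ≥ [p̃_L(0,h) − p̃_L(0,0)] − K|U|h²/β ≥ [free gain] − h²` once
  `|U| ≤ 1/(K+1)`, and the free gain is `≥ c h² log(1/(|h|+1/β)) − C_sw h²` by the shallow-window
  theorem at `U = 0`. With `U₁ := min(δ², δ, 1/(K+1))` the deep regime forces `|h| < δ`.
Constants: `c = c₀`, `C = C_sw + 1`, `h₀ = 1/4` (those of p96342), `L₀ = max(L₀^{sw}(β,μ), 3)`.

Sources: G. Benfatto, A. Giuliani, V. Mastropietro, Ann. Henri Poincaré 7 (2006) 809–898, §2 (2.77)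
(single-scale bound); M. Salmhofer, *Renormalization* (1999) §4.5.4 (Cooper logarithm). Tree:
`ThermalWedgeTwSourcedCondensationShallowWindow`, `Literature/…/DWaveSourceTorusJointPressureEven`.
No definition, no named fact.
-/

noncomputable section

namespace Summit.HubbardSuperconductivity.HubbardSuperconductivity.Theorems

open Matrix Finset Literature.MathematicalPhysics.QuantumLattice

/-- **`TwSourcedCondensation` at fixed temperature.** For every compact `[μ₁,μ₂] ⊂ (-4,0)` there are
`c, C, h₀ > 0` such that for every `β ≥ 1`, `μ ∈ [μ₁,μ₂]` there is `U₁ > 0` with, eventually in `L`,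
for all real `U`, `h` with `|U| ≤ U₁`, `|h| ≤ h₀`:
`c h² log(1/(|h|+1/β)) − C h² ≤ p̃_L(β,U,μ,h) − p̃_L(β,U,μ,0)`.
Shallow window (p96342) for `|U| ≤ h²`; single-scale mixed-increment bound (p129311) plus the free
Cooper logarithm for `h² < |U|`. [cite: BenfattoGiulianiMastropietro2006, (2.77)] -/
theorem twSourcedCondensation_fixedTemperature :
    ∀ μ₁ μ₂ : ℝ, -4 < μ₁ → μ₁ ≤ μ₂ → μ₂ < 0 → ∃ c C h₀ : ℝ, 0 < c ∧ 0 < C ∧ 0 < h₀ ∧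
      ∀ β : ℝ, 1 ≤ β → ∀ μ ∈ Set.Icc μ₁ μ₂, ∃ U₁ : ℝ, 0 < U₁ ∧ ∃ L₀ : ℕ, ∀ (L : ℕ) [NeZero L],
        L₀ ≤ L → ∀ U h : ℝ, |U| ≤ U₁ → |h| ≤ h₀ →
          c * h ^ 2 * Real.log (1 / (|h| + 1 / β)) - C * h ^ 2 ≤
            Real.log (Matrix.partitionFn β
                (Literature.MathematicalPhysics.QuantumLattice.dWaveSourceTorus L U μ h)).re /
                (β * (L : ℝ) ^ 2) -
              Real.log (Matrix.partitionFn β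
                (Literature.MathematicalPhysics.QuantumLattice.dWaveSourceTorus L U μ 0)).re /
                (β * (L : ℝ) ^ 2) := by
  classical
  intro μ₁ μ₂ h4 h12 h0
  obtain ⟨c, C, h₀, hc, hC, hh₀, hSW⟩ := twSourcedCondensation_shallowWindow μ₁ μ₂ h4 h12 h0
  refine ⟨c, C + 1, h₀, hc, by linarith, hh₀, ?_⟩
  intro β hβ μ hμ
  have hβ0 : 0 < β := by linarith
  obtain ⟨δ, hδ, K, hK, hmix⟩ :=
    dWaveSourceTorus_log_partitionFn_mixed_increment_le_sq β μ hβ0.le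
  obtain ⟨L₁, hL₁⟩ := hSW β hβ μ hμ
  refine ⟨min (δ ^ 2) (min δ (1 / (K + 1))), by positivity, max L₁ 3, ?_⟩
  intro L _ hL U h hU hh
  have hL₁L : L₁ ≤ L := le_of_max_le_left hL
  have hL3 : 3 ≤ L := le_of_max_le_right hL
  have hsq : 0 ≤ h ^ 2 := sq_nonneg h
  rcases le_or_gt |U| (h ^ 2) with hshallow | hdeep
  · -- shallow window `|U| ≤ h²`
    have key := hL₁ L hL₁L U h hh hshallow
    have hmono : (C + 1) * h ^ 2 ≥ C * h ^ 2 := by nlinarith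
    linarith
  · -- deep regime `h² < |U| ≤ U₁`
    have hUδ2 : |U| ≤ δ ^ 2 := hU.trans (min_le_left _ _)
    have hUδ : |U| ≤ δ := hU.trans ((min_le_right _ _).trans (min_le_left _ _))
    have hUK : |U| ≤ 1 / (K + 1) := hU.trans ((min_le_right _ _).trans (min_le_right _ _))
    have hhδ : |h| ≤ δ := (abs_lt_of_sq_lt_sq (hdeep.trans_le hUδ2) hδ.le).le
    -- the free gain, from the shallow-window theorem at `U = 0`
    have hfree := hL₁ L hL₁L 0 h hh (by rw [abs_zero]; exact hsq)
    -- the single-scale mixed increment (the Literature file elaborates `partitionFn` through a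
    -- different `DecidableEq` path on the orbital type; `convert` bridges the instance arguments)
    have hm0 : |Real.log (Matrix.partitionFn β (dWaveSourceTorus L U μ h)).re -
          Real.log (Matrix.partitionFn β (dWaveSourceTorus L U μ 0)).re -
          Real.log (Matrix.partitionFn β (dWaveSourceTorus L 0 μ h)).re +
          Real.log (Matrix.partitionFn β (dWaveSourceTorus L 0 μ 0)).re| ≤
        K * (L : ℝ) ^ 2 * |U| * h ^ 2 := by
      convert hmix L hL3 U h hUδ hhδ
    have hm := abs_le.mp hm0
    have hLpos : (0 : ℝ) < L := by exact_mod_cast Nat.pos_of_ne_zero (NeZero.ne L)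
    have hβL : 0 < β * (L : ℝ) ^ 2 := by positivity
    -- `K L² |U| h² ≤ β L² h²`
    have hKU : K * |U| ≤ 1 := by
      have h1 : |U| * (K + 1) ≤ 1 := by
        have := hUK
        rwa [le_div_iff₀ (by positivity)] at this
      nlinarith [abs_nonneg U]
    have hslack : K * (L : ℝ) ^ 2 * |U| * h ^ 2 ≤ β * (L : ℝ) ^ 2 * h ^ 2 := by
      have hL2h : 0 ≤ (L : ℝ) ^ 2 * h ^ 2 := by positivity
      calc K * (L : ℝ) ^ 2 * |U| * h ^ 2 = (K * |U|) * ((L : ℝ) ^ 2 * h ^ 2) := by ring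
        _ ≤ 1 * ((L : ℝ) ^ 2 * h ^ 2) := mul_le_mul_of_nonneg_right hKU hL2h
        _ ≤ β * ((L : ℝ) ^ 2 * h ^ 2) := mul_le_mul_of_nonneg_right hβ hL2h
        _ = β * (L : ℝ) ^ 2 * h ^ 2 := by ring
    rw [← sub_div] at hfree ⊢
    rw [le_div_iff₀ hβL] at hfree ⊢
    have hring : (c * h ^ 2 * Real.log (1 / (|h| + 1 / β)) - (C + 1) * h ^ 2) * (β * (L : ℝ) ^ 2) =
        (c * h ^ 2 * Real.log (1 / (|h| + 1 / β)) - C * h ^ 2) * (β * (L : ℝ) ^ 2) -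
          β * (L : ℝ) ^ 2 * h ^ 2 := by ring
    rw [hring]
    linarith [hm.1, hm.2, hfree, hslack]

end Summit.HubbardSuperconductivity.HubbardSuperconductivity.Theorems
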